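import Summits.QuantumFields.YangMills.Theorems.ColdStartUniversalityLatticeLangevinRidgeOrthogonal
import Summits.QuantumFields.YangMills.Theorems.ColdStartUniversalityLatticeLangevinLatitudeEigen
import HarnessLib

/-!
# Route `ColdStartUniversality`, crux K_A1 `UniformColdStartMixing` (stmt-QuantumFields-24809), rung `stub_fixedCutoffMixing`:
# (Inv) groundwork I1b — degree-weighted operators on ridge form are Haar-symmetric

Helper file (seat `ym-line-csu-p1`, g7).  For two ridge-form functions `F = Σ_j c_j F_j`, `G = Σ_i c'_i G_i` on `SU(2)^E` and any
weight `ρ` of the degree vector, `∫ G · (Σ_j c_j ρ(m_j) F_j) dHaar^E = ∫ F · (Σ_i c'_i ρ(m'_i) G_i) dHaar^E`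
(`integral_ridge_weighted_symm`; Haar orthogonality of different degree vectors, brick I1a).  With `ρ(m) = e^{-λ_m r}` this is
the Haar symmetry of the `β' = 0` semigroup on ridge form, with `ρ(m) = -λ_m` that of its generator — step I1 of the (Inv) plan.
No definition, no sorry.  RECORD-rung R3 plumbing.
-/

set_option autoImplicit false

noncomputable section

namespace Summit.QuantumFields.YangMills.Theorems.ColdStartUniversality

open MeasureTheory Finset
open scoped BigOperators
open Literature.MathematicalPhysics.QuantumFieldTheory
open Literature.MathematicalPhysics.QuantumLattice (fundamentalRep)
open Literature.Analysis.SpecialFunctions (gegenbauerSum)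

variable {L : ℕ} [NeZero L]

/-- **Degree-weighted operators on ridge form are Haar-symmetric.** [folklore] -/
theorem integral_ridge_weighted_symm (ρ : (Edge 3 L → ℕ) → ℝ)
    {κ : Type} [Fintype κ] (c : κ → ℝ) (g : κ → Edge 3 L → Matrix.specialUnitaryGroup (Fin 2) ℂ) (m : κ → Edge 3 L → ℕ)
    {κ' : Type} [Fintype κ'] (c' : κ' → ℝ) (g' : κ' → Edge 3 L → Matrix.specialUnitaryGroup (Fin 2) ℂ) (m' : κ' → Edge 3 L → ℕ) :
    ∫ y, (∑ i, c' i * ∏ e, gegenbauerSum 1 (m' i e) (hsForm 2 (fundamentalRep (Fin 2) (g' i e)) (fundamentalRep (Fin 2) (y e)) / 2)) *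
        (∑ j, c j * ρ (m j) * ∏ e, gegenbauerSum 1 (m j e) (hsForm 2 (fundamentalRep (Fin 2) (g j e)) (fundamentalRep (Fin 2) (y e)) / 2))
      ∂(Measure.pi fun _ : Edge 3 L => haarProbability (Matrix.specialUnitaryGroup (Fin 2) ℂ)) =
    ∫ y, (∑ j, c j * ∏ e, gegenbauerSum 1 (m j e) (hsForm 2 (fundamentalRep (Fin 2) (g j e)) (fundamentalRep (Fin 2) (y e)) / 2)) *
        (∑ i, c' i * ρ (m' i) * ∏ e, gegenbauerSum 1 (m' i e) (hsForm 2 (fundamentalRep (Fin 2) (g' i e)) (fundamentalRep (Fin 2) (y e)) / 2))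
      ∂(Measure.pi fun _ : Edge 3 L => haarProbability (Matrix.specialUnitaryGroup (Fin 2) ℂ)) := by
  classical
  haveI : IsProbabilityMeasure (haarProbability (Matrix.specialUnitaryGroup (Fin 2) ℂ)) := inferInstance
  set H : Measure (GaugeConfig 3 L (Matrix.specialUnitaryGroup (Fin 2) ℂ)) :=
    Measure.pi fun _ : Edge 3 L => haarProbability (Matrix.specialUnitaryGroup (Fin 2) ℂ) with hH
  haveI : IsProbabilityMeasure H := by rw [hH]; infer_instance
  -- integrability of products of ridge products
  have hint : ∀ (i : κ') (j : κ), Integrable (fun y : GaugeConfig 3 L (Matrix.specialUnitaryGroup (Fin 2) ℂ) =>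
      (∏ e, gegenbauerSum 1 (m' i e) (hsForm 2 (fundamentalRep (Fin 2) (g' i e)) (fundamentalRep (Fin 2) (y e)) / 2)) *
        ∏ e, gegenbauerSum 1 (m j e) (hsForm 2 (fundamentalRep (Fin 2) (g j e)) (fundamentalRep (Fin 2) (y e)) / 2)) H := by
    intro i j
    have hc := (continuous_prod_gegenbauer_latitude (L := L) (g' i) (m' i)).mul
      (continuous_prod_gegenbauer_latitude (L := L) (g j) (m j))
    obtain ⟨M, -, hM⟩ := exists_abs_le_of_continuous hc
    exact Integrable.of_bound hc.measurable.aestronglyMeasurable M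
      (Filter.Eventually.of_forall fun y => by rw [Real.norm_eq_abs]; exact hM _)
  -- the pairings
  have hpair : ∀ (i : κ') (j : κ), ∫ y, (∏ e, gegenbauerSum 1 (m' i e)
      (hsForm 2 (fundamentalRep (Fin 2) (g' i e)) (fundamentalRep (Fin 2) (y e)) / 2)) *
        ∏ e, gegenbauerSum 1 (m j e) (hsForm 2 (fundamentalRep (Fin 2) (g j e)) (fundamentalRep (Fin 2) (y e)) / 2) ∂H =
      ∏ e, (if m' i e = m j e then gegenbauerSum 1 (m' i e)
        (hsForm 2 (fundamentalRep (Fin 2) (g' i e)) (fundamentalRep (Fin 2) (g j e)) / 2) / ((m' i e : ℝ) + 1) else 0) :=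
    fun i j => integral_prod_gegenbauer_mul_prod_gegenbauer_pi_haar (g' i) (g j) (m' i) (m j)
  -- expand both sides into double sums of pairings
  have hL : ∫ y, (∑ i, c' i * ∏ e, gegenbauerSum 1 (m' i e) (hsForm 2 (fundamentalRep (Fin 2) (g' i e)) (fundamentalRep (Fin 2) (y e)) / 2)) *
        (∑ j, c j * ρ (m j) * ∏ e, gegenbauerSum 1 (m j e) (hsForm 2 (fundamentalRep (Fin 2) (g j e)) (fundamentalRep (Fin 2) (y e)) / 2)) ∂H =
      ∑ i, ∑ j, c' i * (c j * ρ (m j)) * ∫ y, (∏ e, gegenbauerSum 1 (m' i e)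
        (hsForm 2 (fundamentalRep (Fin 2) (g' i e)) (fundamentalRep (Fin 2) (y e)) / 2)) *
        ∏ e, gegenbauerSum 1 (m j e) (hsForm 2 (fundamentalRep (Fin 2) (g j e)) (fundamentalRep (Fin 2) (y e)) / 2) ∂H := by
    have hexp : ∀ y : GaugeConfig 3 L (Matrix.specialUnitaryGroup (Fin 2) ℂ),
        (∑ i, c' i * ∏ e, gegenbauerSum 1 (m' i e) (hsForm 2 (fundamentalRep (Fin 2) (g' i e)) (fundamentalRep (Fin 2) (y e)) / 2)) *
        (∑ j, c j * ρ (m j) * ∏ e, gegenbauerSum 1 (m j e) (hsForm 2 (fundamentalRep (Fin 2) (g j e)) (fundamentalRep (Fin 2) (y e)) / 2)) =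
        ∑ i, ∑ j, c' i * (c j * ρ (m j)) * ((∏ e, gegenbauerSum 1 (m' i e)
          (hsForm 2 (fundamentalRep (Fin 2) (g' i e)) (fundamentalRep (Fin 2) (y e)) / 2)) *
          ∏ e, gegenbauerSum 1 (m j e) (hsForm 2 (fundamentalRep (Fin 2) (g j e)) (fundamentalRep (Fin 2) (y e)) / 2)) := by
      intro y
      rw [Finset.sum_mul_sum]
      exact Finset.sum_congr rfl fun i _ => Finset.sum_congr rfl fun j _ => by ring
    simp_rw [hexp]
    rw [integral_finsetSum _ fun i _ => integrable_finsetSum _ fun j _ => (hint i j).const_mul _]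
    refine Finset.sum_congr rfl fun i _ => ?_
    rw [integral_finsetSum _ fun j _ => (hint i j).const_mul _]
    exact Finset.sum_congr rfl fun j _ => integral_const_mul _ _
  have hR : ∫ y, (∑ j, c j * ∏ e, gegenbauerSum 1 (m j e) (hsForm 2 (fundamentalRep (Fin 2) (g j e)) (fundamentalRep (Fin 2) (y e)) / 2)) *
        (∑ i, c' i * ρ (m' i) * ∏ e, gegenbauerSum 1 (m' i e) (hsForm 2 (fundamentalRep (Fin 2) (g' i e)) (fundamentalRep (Fin 2) (y e)) / 2)) ∂H =
      ∑ i, ∑ j, c' i * ρ (m' i) * c j * ∫ y, (∏ e, gegenbauerSum 1 (m' i e)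
        (hsForm 2 (fundamentalRep (Fin 2) (g' i e)) (fundamentalRep (Fin 2) (y e)) / 2)) *
        ∏ e, gegenbauerSum 1 (m j e) (hsForm 2 (fundamentalRep (Fin 2) (g j e)) (fundamentalRep (Fin 2) (y e)) / 2) ∂H := by
    have hexp : ∀ y : GaugeConfig 3 L (Matrix.specialUnitaryGroup (Fin 2) ℂ),
        (∑ j, c j * ∏ e, gegenbauerSum 1 (m j e) (hsForm 2 (fundamentalRep (Fin 2) (g j e)) (fundamentalRep (Fin 2) (y e)) / 2)) *
        (∑ i, c' i * ρ (m' i) * ∏ e, gegenbauerSum 1 (m' i e) (hsForm 2 (fundamentalRep (Fin 2) (g' i e)) (fundamentalRep (Fin 2) (y e)) / 2)) =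
        ∑ i, ∑ j, c' i * ρ (m' i) * c j * ((∏ e, gegenbauerSum 1 (m' i e)
          (hsForm 2 (fundamentalRep (Fin 2) (g' i e)) (fundamentalRep (Fin 2) (y e)) / 2)) *
          ∏ e, gegenbauerSum 1 (m j e) (hsForm 2 (fundamentalRep (Fin 2) (g j e)) (fundamentalRep (Fin 2) (y e)) / 2)) := by
      intro y
      rw [Finset.sum_mul_sum, Finset.sum_comm]
      exact Finset.sum_congr rfl fun i _ => Finset.sum_congr rfl fun j _ => by ring
    simp_rw [hexp]
    rw [integral_finsetSum _ fun i _ => integrable_finsetSum _ fun j _ => (hint i j).const_mul _]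
    refine Finset.sum_congr rfl fun i _ => ?_
    rw [integral_finsetSum _ fun j _ => (hint i j).const_mul _]
    exact Finset.sum_congr rfl fun j _ => integral_const_mul _ _
  rw [hL, hR]
  refine Finset.sum_congr rfl fun i _ => Finset.sum_congr rfl fun j _ => ?_
  by_cases hmm : m' i = m j
  · rw [hmm]; ring
  · rw [hpair i j]
    obtain ⟨e, he⟩ := Function.ne_iff.1 hmm
    rw [Finset.prod_eq_zero (Finset.mem_univ e) (if_neg he), mul_zero, mul_zero]

end Summit.QuantumFields.YangMills.Theorems.ColdStartUniversality

end
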